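import Mathlib.Algebra.MvPolynomial.NoZeroDivisors
import Literature.Computability.Complexity.SumOfSquaresRefutation
import HarnessLib

/-!
# Pseudoexpectations refute static sum-of-squares refutations (weak duality)

The easy half of SOS duality for the tree's static Positivstellensatz refutations
`HasSOSRefutation S d` (`SumOfSquaresRefutation.lean`; Grigoriev–Vorobjov `PS>` for systems of
EQUATIONS, half-degree `d`: `Σ_l q_l² + Σ_e g_e · S e = -1`, `deg q_l ≤ d`, `deg (g_e · S e) ≤ 2d`):
if a linear functional `E` on the polynomial ring is positive on `1`, nonnegative on squares of
polynomials of degree `≤ d`, and vanishes on every product `g · S e` of degree `≤ 2d`, then applying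
`E` to a refutation identity gives `0 ≤ Σ E(q_l²) + Σ E(g_e S e) = -E(1) < 0` — so no refutation of
half-degree `d` exists (`not_hasSOSRefutation_of_functional`). This is how every SOS degree LOWER
bound is proved (Grigoriev 2001: "the theorem in Section 2" builds such a functional from Laurent
proofs; Barak–Steurer / Kothari–Mori–O'Donnell–Witmer: "degree-`d` SOS fails to refute iff a
degree-`d` pseudoexpectation exists", the primal half of which is this lemma).

Over a linearly ordered (hence zero-divisor free) coefficient ring the vanishing condition may be
checked on the honest degrees `deg g + deg (S e) ≤ 2d` instead of the degree of the product
(`not_hasSOSRefutation_of_functional'`, via `MvPolynomial.totalDegree_mul_of_isDomain`), which is the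
form in which pseudoexpectations are usually specified (Kothari–Mori–O'Donnell–Witmer 2017,
Def. 2.8: "`Ẽ` satisfies the identity `q = 0` if `Ẽ[q r] = 0` for all `r` with
`deg q + deg r ≤ d`"; the tree's `SatisfiesIdentity` in `MetaComplexity/SumOfSquares.lean` is that
notion for variables indexed by `ℕ`, here the variable type is arbitrary).

No new definitions: the functional is an explicit hypothesis, so that the lemma applies verbatim to
`Literature.Computability.MetaComplexity.IsPseudoexpectation`-style functionals and to the
Grigoriev–Schoenebeck moment functionals (`XorPseudoexpectation.lean`).

## References

* D. Grigoriev, *Complexity of Positivstellensatz proofs for the knapsack*, Comput. Complexity 10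
  (2001), Def. 0.5 and §1 (lower bounds via a linear form vanishing on the ideal part and
  nonnegative on squares). [Grigoriev2001]
* D. Grigoriev, *Linear lower bound on degrees of Positivstellensatz calculus proofs for the
  parity*, Theoret. Comput. Sci. 259 (2001) 613–622, §2 (the Theorem). [Grigoriev2001TCS]
* P. K. Kothari, R. Mori, R. O'Donnell, D. Witmer, *Sum of squares lower bounds for refuting any
  CSP*, STOC 2017, arXiv:1701.04521, Defs. 2.7–2.8, §2.3.
-/

noncomputable section

open MvPolynomial Finset

namespace Literature.Computability.Complexity

variable {ι σ K : Type*} [CommRing K] [LinearOrder K] [IsStrictOrderedRing K] [Fintype ι]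

/-- **Weak SOS duality (pseudoexpectation ⇒ no refutation).** If a linear functional `E` on
`K[X_σ]` has `E 1 > 0`, `E (q²) ≥ 0` whenever `deg q ≤ d`, and `E (g · S e) = 0` whenever
`deg (g · S e) ≤ 2d`, then the system `{S e = 0}` has no static sum-of-squares refutation of
half-degree `d`: applying `E` to `Σ q_l² + Σ g_e S e = -1` gives `0 ≤ -E 1 < 0`.
[cite: Grigoriev2001, Def. 0.5 and §1] -/
theorem not_hasSOSRefutation_of_functional {S : ι → MvPolynomial σ K} {d : ℕ}
    (E : MvPolynomial σ K →ₗ[K] K) (h1 : 0 < E 1)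
    (hsq : ∀ q : MvPolynomial σ K, q.totalDegree ≤ d → 0 ≤ E (q * q))
    (hid : ∀ (e : ι) (g : MvPolynomial σ K), (g * S e).totalDegree ≤ 2 * d → E (g * S e) = 0) :
    ¬ HasSOSRefutation S d := by
  rintro ⟨m, q, g, hq, hg, hsum⟩
  have hE := congrArg E hsum
  rw [map_add, map_sum, map_sum, map_neg] at hE
  have hsq' : (0 : K) ≤ ∑ l, E (q l * q l) := sum_nonneg fun l _ => hsq (q l) (hq l)
  have hid' : ∑ e, E (g e * S e) = 0 := sum_eq_zero fun e _ => hid e (g e) (hg e)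
  rw [hid', add_zero] at hE
  rw [hE] at hsq'
  linarith

/-- **Weak SOS duality, honest-degree form.** Over a linearly ordered coefficient ring (no zero
divisors, so `deg (g · S e) = deg g + deg (S e)` for `g ≠ 0`), it suffices that `E (g · S e) = 0`
whenever `deg g + deg (S e) ≤ 2d` — the usual specification of a degree-`2d` pseudoexpectation
"satisfying the identities `S e = 0`". [cite: Grigoriev2001, Def. 0.5 and §1] -/
theorem not_hasSOSRefutation_of_functional' {S : ι → MvPolynomial σ K} {d : ℕ}
    (E : MvPolynomial σ K →ₗ[K] K) (h1 : 0 < E 1)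
    (hsq : ∀ q : MvPolynomial σ K, q.totalDegree ≤ d → 0 ≤ E (q * q))
    (hid : ∀ (e : ι) (g : MvPolynomial σ K),
      g.totalDegree + (S e).totalDegree ≤ 2 * d → E (g * S e) = 0) :
    ¬ HasSOSRefutation S d := by
  refine not_hasSOSRefutation_of_functional E h1 hsq fun e g hdeg => ?_
  by_cases hg : g = 0
  · rw [hg, zero_mul, map_zero]
  by_cases hS : S e = 0
  · rw [hS, mul_zero, map_zero]
  · refine hid e g ?_
    rwa [← totalDegree_mul_of_isDomain hg hS]

/-- The same with the functional normalised, `E 1 = 1` (the form produced by pseudo-moment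
constructions, e.g. `Literature.Computability.MetaComplexity.gsPseudoexpectation`).
[cite: Grigoriev2001, Def. 0.5 and §1] -/
theorem not_hasSOSRefutation_of_pseudoexpectation {S : ι → MvPolynomial σ K} {d : ℕ}
    (E : MvPolynomial σ K →ₗ[K] K) (h1 : E 1 = 1)
    (hsq : ∀ q : MvPolynomial σ K, q.totalDegree ≤ d → 0 ≤ E (q * q))
    (hid : ∀ (e : ι) (g : MvPolynomial σ K),
      g.totalDegree + (S e).totalDegree ≤ 2 * d → E (g * S e) = 0) :
    ¬ HasSOSRefutation S d :=
  not_hasSOSRefutation_of_functional' E (by rw [h1]; exact one_pos) hsq hid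

end Literature.Computability.Complexity
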